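import Summits.BirchSwinnertonDyer.BirchSwinnertonDyer.Theorems.GenusKolyvaginAtTwoEquivariantKolyvaginExactAtTwoEigenClassesFinite
import Literature.NumberTheory.EllipticCurves.H1CorestrictionIndexTwo
import Literature.NumberTheory.EllipticCurves.SelmerTorsionRestriction
import Literature.NumberTheory.EllipticCurves.GeomPointsGaloisModule
import Literature.NumberTheory.EllipticCurves.QuadraticTwistRationalTorsionFiniteProofs
import Literature.NumberTheory.GaloisRepresentations.ContinuousH1ResCocycle
import Literature.NumberTheory.GaloisRepresentations.TateH2VanishingArchimedean
import Literature.NumberTheory.GaloisRepresentations.LocalGlobalCohomology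
import HarnessLib

/-!
# Route `GenusKolyvaginAtTwo`, crux #2 `GenusPrimitiveSupplyAtTwo` (stmt-BirchSwinnertonDyer-22136):
# CORESTRICTION ALONG AN IMAGINARY QUADRATIC FIELD KILLS THE REAL PLACE —
# `m + σ·m = res_K y` with `loc_∞ y = 0`, for every `m ∈ H¹(K, E_K[n])`

Width seat `bsd-line-gk2-p5` g17 (cell `bsd-f1-sign2`, SUPPLY lineage of crux 22136), file 48 of the series; sequel of file 47
(`…DescentSignShaOverImagQuadratic`: AN-10K BY NAME). THEOREMS ONLY (no definition, no named fact, no `sorry`, no local instance);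
helper `--supports stmt-BirchSwinnertonDyer-22136`; no item is closed; BSD is not proved by any of this.

WHY. The converse half of the cell's AN-10K⁼ `F1Sign2.DescentSignIffShaOverAdmissibleField` (`ε(E) = +1 ⟹ Ш(E/K)[2] = 0` for an
admissible imaginary quadratic `K`) is ARCHIMEDEAN: by the `𝔽₂[Gal(K/ℚ)]`-module structure of `Sel₂(E/K)` the only obstruction is a
class `m` with `σm = m + res_K κ(P₀)`, i.e. `res_K (cor m) = res_K κ(P₀)`, and `cor m` is trivial at the real place while `κ(P₀)` is
not when `P₀` lies on the egg. This file supplies the corestriction step in the tree's currencies (`resTorsion`, `conjAct`,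
`galoisCohomology.localization … (Sum.inl Rat.infinitePlace)`):

* §203 index-two coset bookkeeping (`xor_mem_of_index_two`, `inv_mul_mem_of_index_two`);
* §204 `eq_one_of_resGal_mem_galRange_of_sq_eq_intCast` — **`Γ_{ℚ_∞} ∩ Γ_K = 1` for `K ∋ √d`, `d < 0`**: a non-trivial element of
  `Γ_{ℚ_∞}` restricting into `galRange K` would fix the image of `√d` in `ℚ̄_∞`, hence (`#Γ_{ℚ_∞} ≤ 2`, tree
  `natCard_absoluteGaloisGroup_completion_infinitePlace_le_two`) so would all of `Γ_{ℚ_∞}`, putting `√d` in `ℚ_∞ ≅ ℝ`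
  (`exists_algebraMap_eq_of_forall_smul_eq_algClosure`);
* §205 **`exists_resTorsion_eq_add_conjAct_and_localization_inl_eq_zero`** — for `K/ℚ` Galois quadratic, `σ₀ ≠ 1`, with
  `Γ_{ℚ_∞} ∩ Γ_K = 1`: every `m ∈ H¹(K, E_K[n])` has `y ∈ H¹(ℚ, E[n])` with `res_K y = m + σ₀·m` and `loc_∞ y = 0` — `y = cor m`, the
  tree's explicit index-`2` transfer `corH1` (`H1CorestrictionIndexTwo`: `res ∘ cor = 1 + c_*`) in the subgroup model `modelIsoTorsion`,
  with coset representative `c` = the restriction of complex conjugation, whose transfer cocycle vanishes on `Γ_{ℚ_∞} = {1, c}`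
  (`F(c) = f(c²) = f(1) = 0`); and `…_of_sq_eq_intCast` (the hypothesis fed by §204).

Honest framing: Serre I §2.4 / NSW I §5 bookkeeping (the double-coset formula for `res_∞ ∘ cor_{K/ℚ}` at a place inert-at-infinity), kernel-new
in the tree's two `H¹` currencies; beyond-print theorem: no. Crux 22136 stays OPEN exactly at (U) 24947 ∧ (CONV₂) 19220/24948. BSD is
not proved by any of this.

References: [SerreGaloisCohomology1997] I §2.4 (Res, Cor, Prop. 9), I §2.5; [NeukirchSchmidtWingberg2008] I §5 (1.5.6–1.5.7);
[Kramer1981] Thm. 1 (the `Gal(K/ℚ)`-structure of `S(E/K)`).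
-/

set_option linter.dupNamespace false -- tree convention: `Summit.BirchSwinnertonDyer.BirchSwinnertonDyer.Theorems` (summit = sub-problem)
set_option autoImplicit false

noncomputable section

open scoped Classical

namespace Summit.BirchSwinnertonDyer.BirchSwinnertonDyer.Theorems.GenusKolyArch

open WeierstrassCurve NumberField Field
open Literature.NumberTheory.EllipticCurves Literature.NumberTheory.GaloisRepresentations

/-! ## §203 Index two: coset bookkeeping -/

section IndexTwo

variable {G : Type*} [Group G] {N : Subgroup G}

/-- For a subgroup of index `2` and `c ∉ N`: `G = N ⊔ N c` in the `Xor` form used by the tree's index-`2` transfer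
(`corH1`). [folklore] -/
theorem xor_mem_of_index_two (h : N.index = 2) {c : G} (hc : c ∉ N) (b : G) : Xor (b * c⁻¹ ∈ N) (b ∈ N) := by
  by_cases hb : b ∈ N
  · refine Or.inr ⟨hb, fun h' ↦ hc ?_⟩
    have := (Subgroup.mul_mem_iff_of_index_two h).mp h'
    exact N.inv_mem_iff.mp (this.mp hb)
  · refine Or.inl ⟨?_, hb⟩
    rw [Subgroup.mul_mem_iff_of_index_two h, N.inv_mem_iff]
    exact ⟨fun h' ↦ absurd h' hb, fun h' ↦ absurd h' hc⟩

/-- Two elements outside a subgroup of index `2` differ by an element of the subgroup. [folklore] -/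
theorem inv_mul_mem_of_index_two (h : N.index = 2) {a b : G} (ha : a ∉ N) (hb : b ∉ N) : a⁻¹ * b ∈ N := by
  rw [Subgroup.mul_mem_iff_of_index_two h, N.inv_mem_iff]
  exact ⟨fun h' ↦ absurd h' ha, fun h' ↦ absurd h' hb⟩

end IndexTwo

/-! ## §204 The real place of `ℚ` sees an imaginary quadratic field: `Γ_{ℚ_∞} ∩ Γ_K = 1` -/

section RealPlace

variable (K : Type) [Field K] [NumberField K]

/-- **No non-trivial element of `Γ_{ℚ_∞}` restricts into `Γ_K` when `K` contains a square root of a negative integer.**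
If `g ∈ Gal(ℚ̄_∞/ℚ_∞)` restricts into `galRange K ≤ Γ_ℚ` then `g` fixes the image `z` of `√d ∈ K` in `ℚ̄_∞`; if moreover
`g ≠ 1` then, `Γ_{ℚ_∞}` having at most two elements, EVERY element of `Γ_{ℚ_∞}` fixes `z`, so `z ∈ ℚ_∞ ≅ ℝ` (Galois descent in
`ℚ̄_∞`) with `z² = d < 0` — impossible. (Complex conjugation is not trivial on an imaginary quadratic field.)
[cite: SerreGaloisCohomology1997, I §2.4 (G = Gal(ℂ/ℝ))] -/
theorem eq_one_of_resGal_mem_galRange_of_sq_eq_intCast {i : K} {d : ℤ} (hi : i ^ 2 = (d : K)) (hd : d < 0)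
    (g : absoluteGaloisGroup (Place.Completion (Sum.inl Rat.infinitePlace : Place ℚ)))
    (hg : resGal (K := ℚ) (Place.Completion (Sum.inl Rat.infinitePlace : Place ℚ)) g ∈ galRange (K := ℚ) K) : g = 1 := by
  by_contra hg1
  haveI : Algebra.IsAlgebraic ℚ K := Algebra.IsAlgebraic.of_finite ℚ K
  set ι : AlgebraicClosure ℚ →ₐ[ℚ] AlgebraicClosure (Place.Completion (Sum.inl Rat.infinitePlace : Place ℚ)) :=
    closureEmb (K := ℚ) (Place.Completion (Sum.inl Rat.infinitePlace : Place ℚ)) with hι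
  set z : AlgebraicClosure (Place.Completion (Sum.inl Rat.infinitePlace : Place ℚ)) := ι (embIntoClosure (K := ℚ) K i) with hz
  -- `g` fixes `z`
  have hgz : g • z = z := by
    have h1 := smul_embIntoClosure_of_mem_galRange (K := ℚ) K hg i
    have h2 := apply_resGalAuxOfEmb_apply ι g (embIntoClosure (K := ℚ) K i)
    exact (h2.symm.trans (congrArg ι h1)).trans hz.symm
  -- every element of `Γ_{ℚ_∞}` is `1` or `g`
  haveI : Finite (absoluteGaloisGroup (Place.Completion (Sum.inl Rat.infinitePlace : Place ℚ))) := finite_absoluteGaloisGroup_completion_infinitePlace Rat.infinitePlace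
  have hcard : Nat.card (absoluteGaloisGroup (Place.Completion (Sum.inl Rat.infinitePlace : Place ℚ))) ≤ 2 :=
    natCard_absoluteGaloisGroup_completion_infinitePlace_le_two Rat.infinitePlace
  have hall : ∀ h : absoluteGaloisGroup (Place.Completion (Sum.inl Rat.infinitePlace : Place ℚ)), h = 1 ∨ h = g := by
    intro h
    by_contra hh
    rw [not_or] at hh
    haveI : Fintype (absoluteGaloisGroup (Place.Completion (Sum.inl Rat.infinitePlace : Place ℚ))) := Fintype.ofFinite _
    have h3 : Finset.card ({1, g, h} : Finset (absoluteGaloisGroup (Place.Completion (Sum.inl Rat.infinitePlace : Place ℚ)))) = 3 := by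
      rw [Finset.card_insert_of_notMem (by simp [Ne.symm hg1, Ne.symm hh.1]),
        Finset.card_insert_of_notMem (by simp [Ne.symm hh.2]), Finset.card_singleton]
    have := Finset.card_le_univ ({1, g, h} : Finset (absoluteGaloisGroup (Place.Completion (Sum.inl Rat.infinitePlace : Place ℚ))))
    rw [h3, ← Nat.card_eq_fintype_card] at this
    omega
  have hfix : ∀ h : absoluteGaloisGroup (Place.Completion (Sum.inl Rat.infinitePlace : Place ℚ)), h • z = z := by
    intro h
    rcases hall h with rfl | rfl
    · exact one_smul _ _
    · exact hgz
  -- hence `z ∈ ℚ_∞`, with `z² = d`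
  haveI : CharZero (Place.Completion (Sum.inl Rat.infinitePlace : Place ℚ)) := charZero_of_injective_algebraMap (algebraMap ℚ (Place.Completion (Sum.inl Rat.infinitePlace : Place ℚ))).injective
  obtain ⟨c, hc⟩ := exists_algebraMap_eq_of_forall_smul_eq_algClosure hfix
  have hz2 : z ^ 2 = ((d : ℤ) : AlgebraicClosure (Place.Completion (Sum.inl Rat.infinitePlace : Place ℚ))) := by
    rw [hz, ← map_pow, ← map_pow, hi, map_intCast, map_intCast]
  have hc2 : c ^ 2 = ((d : ℤ) : (Place.Completion (Sum.inl Rat.infinitePlace : Place ℚ))) := by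
    apply (algebraMap (Place.Completion (Sum.inl Rat.infinitePlace : Place ℚ)) (AlgebraicClosure (Place.Completion (Sum.inl Rat.infinitePlace : Place ℚ)))).injective
    rw [map_pow, hc, hz2, map_intCast]
  -- read in `ℝ`
  let e : (Place.Completion (Sum.inl Rat.infinitePlace : Place ℚ)) ≃+* ℝ := InfinitePlace.Completion.ringEquivRealOfIsReal Rat.isReal_infinitePlace
  have hreal : (e c) ^ 2 = (d : ℝ) := by
    rw [← map_pow, hc2, map_intCast]
  have hd' : (d : ℝ) < 0 := by exact_mod_cast hd
  nlinarith [sq_nonneg (e c)]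

end RealPlace

/-! ## §205 Corestriction along a quadratic `K` in which `∞` does not split: `m + σ m = res y` with `y` trivial at `∞` -/

section Cor

variable (W : WeierstrassCurve ℚ) (K : Type) [Field K] [NumberField K]

/-- **Corestriction kills the real place.** Let `K/ℚ` be a Galois quadratic field with non-trivial automorphism `σ₀` such that no
non-trivial element of `Γ_{ℚ_∞}` restricts into `Γ_K` (e.g. `K` imaginary quadratic, §204), and `n : ℤ`. For every class
`m ∈ H¹(K, E_K[n])` there is `y ∈ H¹(ℚ, E[n])` — the corestriction `cor_{K/ℚ} m` — with `res_K y = m + σ₀·m` AND `loc_∞ y = 0` in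
`H¹(ℚ_∞, E[n])`. In the subgroup model (`modelIsoTorsion`) `y = cor m` is the tree's index-`2` transfer `corH1` for the coset
representative `c` = (the restriction of) complex conjugation when `Γ_{ℚ_∞} ≠ 1`: `res ∘ cor = 1 + c_*` (`resSubgroupH1_corH1`, and
`c_* = (σ₀)_*` as `c ∉ Γ_K`), while the transfer cocycle `F` has `F(1) = 0` and `F(c) = f(c²) = f(1) = 0`, so its pull-back to
`Γ_{ℚ_∞} = {1, c}` vanishes identically. [cite: SerreGaloisCohomology1997, I §2.4 (Res, Cor)] [cite: NeukirchSchmidtWingberg2008, I §5 (1.5.6)] -/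
theorem exists_resTorsion_eq_add_conjAct_and_localization_inl_eq_zero [IsGalois ℚ K] (h2 : Module.finrank ℚ K = 2)
    {σ₀ : K ≃ₐ[ℚ] K} (hσ₀ : σ₀ ≠ 1)
    (hK : ∀ g : absoluteGaloisGroup (Place.Completion (Sum.inl Rat.infinitePlace : Place ℚ)),
      resGal (K := ℚ) (Place.Completion (Sum.inl Rat.infinitePlace : Place ℚ)) g ∈ galRange (K := ℚ) K → g = 1)
    (n : ℤ) (m : galH1Torsion (W.baseChange K) n) :
    ∃ y : galH1Torsion W n, resTorsion W K n y = m + conjAct W σ₀ n m ∧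
      galoisCohomology.localization (W.torsionGaloisModule n) (Sum.inl Rat.infinitePlace) 1 y = 0 := by
  haveI : Algebra.IsAlgebraic ℚ K := Algebra.IsAlgebraic.of_finite ℚ K
  haveI := normal_galRange K h2 hσ₀
  set N : Subgroup (absoluteGaloisGroup ℚ) := galRange (K := ℚ) K with hN_def
  have hN : IsOpen (N : Set (absoluteGaloisGroup ℚ)) := isOpen_galRange K
  have hidx : N.index = 2 := index_galRange K h2 hσ₀
  have hM : ∀ P : geomTorsion W n, Continuous fun g : absoluteGaloisGroup ℚ ↦ g • P :=
    GenusExact.EigenClassesFinite.continuous_smul_geomTorsion_rat W n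
  have hc₀ : liftToAbsGal (K := ℚ) K σ₀ ∉ N := not_mem_of_xor (xor_galRange K h2 hσ₀)
  -- the coset representative: complex conjugation if `Γ_{ℚ_∞}` is non-trivial on `K`
  have key : ∃ c : absoluteGaloisGroup ℚ, c ∉ N ∧
      ∀ g : absoluteGaloisGroup (Place.Completion (Sum.inl Rat.infinitePlace : Place ℚ)),
        resGal (K := ℚ) (Place.Completion (Sum.inl Rat.infinitePlace : Place ℚ)) g ∉ N → resGal (K := ℚ) (Place.Completion (Sum.inl Rat.infinitePlace : Place ℚ)) g = c := by
    by_cases h : ∃ τ : absoluteGaloisGroup (Place.Completion (Sum.inl Rat.infinitePlace : Place ℚ)),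
        resGal (K := ℚ) (Place.Completion (Sum.inl Rat.infinitePlace : Place ℚ)) τ ∉ N
    · obtain ⟨τ, hτ⟩ := h
      refine ⟨resGal (K := ℚ) (Place.Completion (Sum.inl Rat.infinitePlace : Place ℚ)) τ, hτ, fun g hg ↦ ?_⟩
      have hmem : resGal (K := ℚ) (Place.Completion (Sum.inl Rat.infinitePlace : Place ℚ)) (g * τ⁻¹) ∈ N := by
        rw [map_mul, map_inv, Subgroup.mul_mem_iff_of_index_two hidx, N.inv_mem_iff]
        exact ⟨fun h' ↦ absurd h' hg, fun h' ↦ absurd h' hτ⟩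
      have h1 : g * τ⁻¹ = 1 := hK _ hmem
      rw [mul_inv_eq_one] at h1
      rw [h1]
    · push Not at h
      exact ⟨liftToAbsGal (K := ℚ) K σ₀, hc₀, fun g hg ↦ absurd (h g) hg⟩
  obtain ⟨c, hcN, hcinf⟩ := key
  have hc : ∀ b : absoluteGaloisGroup ℚ, Xor (b * c⁻¹ ∈ N) (b ∈ N) := xor_mem_of_index_two hidx hcN
  set m' := modelIsoTorsion K W n m with hm'
  obtain ⟨f, hf⟩ := oneCocycleClass_surjective _ m'
  refine ⟨corH1 hN hM hc m', ?_, ?_⟩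
  · -- `res (cor m) = m + σ₀ m`
    apply (modelIsoTorsion K W n).injective
    rw [modelIsoTorsion_resTorsion, resSubgroupH1_corH1, map_add, modelIsoTorsion_conjAct K W n σ₀ h2 hσ₀, ← hm']
    congr 1
    have hmem : (liftToAbsGal (K := ℚ) K σ₀)⁻¹ * c ∈ N := inv_mul_mem_of_index_two hidx hc₀ hcN
    conv_lhs => rw [show c = liftToAbsGal (K := ℚ) K σ₀ * ((liftToAbsGal (K := ℚ) K σ₀)⁻¹ * c) by
      rw [mul_inv_cancel_left]]
    rw [conjH1_mul_of_mem N _ hmem]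
  · -- `loc_∞ (cor m) = 0`
    rw [← hf, corH1_oneCocycleClass]
    change galoisCohomology.res (W.torsionGaloisModule n) (Place.Completion (Sum.inl Rat.infinitePlace : Place ℚ)) 1
      (oneCocycleClass (W.torsionGaloisModule n).toTopRep (corCocycle hN hM hc f)) = 0
    rw [galoisCohomology.res_oneCocycleClass]
    refine (oneCocycleClass_eq_zero_iff _ _).mpr ⟨0, fun g ↦ ?_⟩
    rw [galoisCohomology.pullback_absGaloisRestrict_apply, map_zero, sub_zero, corCocycle_apply,
      ← resGal_eq_absGaloisRestrict]
    by_cases hg : resGal (K := ℚ) (Place.Completion (Sum.inl Rat.infinitePlace : Place ℚ)) g ∈ N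
    · rw [hK g hg, map_one, show (1 : absoluteGaloisGroup ℚ) = ((1 : N) : absoluteGaloisGroup ℚ) from rfl,
        corFun_coe, cocycle_one]
    · have hgc : resGal (K := ℚ) (Place.Completion (Sum.inl Rat.infinitePlace : Place ℚ)) g = c := hcinf g hg
      have hcc : c * c = 1 := by
        have hmem : resGal (K := ℚ) (Place.Completion (Sum.inl Rat.infinitePlace : Place ℚ)) (g * g) ∈ N := by
          rw [map_mul, hgc]; exact mul_self_mem_of_xor hc
        rw [← hgc, ← map_mul, hK _ hmem, map_one]
      have hsq : cSq hc = 1 := Subtype.ext (by rw [cSq_coe, hcc]; rfl)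
      have e1 : corFun hc f c = corFun hc f (((1 : N) : absoluteGaloisGroup ℚ) * c) := by
        rw [OneMemClass.coe_one, one_mul]
      rw [hgc, e1, corFun_coe_mul, cocycle_one, hsq, cocycle_one, smul_zero, add_zero]

/-- **Corestriction kills the real place, for `K ∋ √d` with `d < 0`** (§204 supplies the hypothesis of the previous theorem;
`σ₀` any non-trivial automorphism). [cite: SerreGaloisCohomology1997, I §2.4 (Res, Cor)] -/
theorem exists_resTorsion_eq_add_conjAct_and_localization_inl_eq_zero_of_sq_eq_intCast [IsGalois ℚ K]
    (h2 : Module.finrank ℚ K = 2) {σ₀ : K ≃ₐ[ℚ] K} (hσ₀ : σ₀ ≠ 1) {i : K} {d : ℤ} (hi : i ^ 2 = (d : K)) (hd : d < 0)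
    (n : ℤ) (m : galH1Torsion (W.baseChange K) n) :
    ∃ y : galH1Torsion W n, resTorsion W K n y = m + conjAct W σ₀ n m ∧
      galoisCohomology.localization (W.torsionGaloisModule n) (Sum.inl Rat.infinitePlace) 1 y = 0 :=
  exists_resTorsion_eq_add_conjAct_and_localization_inl_eq_zero W K h2 hσ₀
    (eq_one_of_resGal_mem_galRange_of_sq_eq_intCast K hi hd) n m

end Cor


end Summit.BirchSwinnertonDyer.BirchSwinnertonDyer.Theorems.GenusKolyArch

end
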